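import Summits.QuantumAdvantage.QuantumAdvantage.Theorems.MobiusLadderDigitPolyUniformityMRTAligned

/-!
# `DigitPolyUniformity` (stmt-QuantumAdvantage-1392), line `Sketch` — stub `stub_alignedMRT_wide`
# (Matomäki–Radziwiłł–Tao on aligned dyadic blocks at ALL scales `2^{h₀} ≤ 2^h ≤ 2ⁿ/2^{h₀}`)

Cycle 5, wave 2 (seat c5). The registered stub `stub_alignedMRT` (`Theorems/…MRTAligned`, p137786) controls the blocks of
length `2^h` for `h₀ ≤ h ≤ n/2`; here the same statement for `h₀ ≤ h ≤ n − h₀`: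

  `stub_alignedMRT_wide : ∀ ε > 0, ∃ h₀, ∀ᶠ n, ∀ h, h₀ ≤ h → h + h₀ ≤ n → ∀ α : ℝ,
     Σ_{y < 2^{n−h}} ‖Σ_{x < 2^h} λ(2^h y + x) e(α (2^h y + x))‖ ≤ ε 2ⁿ`.

Needed by the two-ends class at EVERY top depth `n − h ∈ [h₀, n − h₀]` (not only `≥ n/2`), which is the test family of the
×p-rigidity statement (`Theorems/…RigidityGlue`, wide form). The proof is that of `stub_alignedMRT` verbatim (MRT 2015
Thm 1.3, PROVED in the tree; `stub_integral_window_eq_sum`; `stub_window_average`; `T = ⌊2^h/M⌋`, `M = ⌈8/ε⌉ + 1`), except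
for the block `y = 0`, now bounded by `2^h ≤ 2ⁿ/2^{h₀} ≤ 2ⁿ/(2M) ≤ ε2ⁿ/16` (`AlignedMRTWide.final_bound_wide`).
No unproved fact is used.
-/

noncomputable section

namespace Summit.QuantumAdvantage.DigitPolyUniformity.SketchLAR

open Filter Finset Real
open Literature.NumberTheory.LFunctions
open Summit.QuantumAdvantage.QuantumAdvantage.Theorems.MobiusLadderQuadraticDigitPhasesStubMomoAPBlocks
  (norm_liouville_mul_e_le)

namespace AlignedMRTWide

/-- The real-number bookkeeping of `stub_alignedMRT_wide` (as `AlignedMRT.final_bound`, with `H² ≤ X` replaced by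
`2M ≤ Y`, `X = HY`: then `H ≤ X/(2M) ≤ εX/16`). [folklore] -/
theorem final_bound_wide {ε C' M H T Y X δ η S I B₀ : ℝ} (hε : 0 < ε) (hC' : 1 ≤ C') (hM0 : 0 < M)
    (hM8 : 8 / ε ≤ M) (hH0 : 0 < H) (hT0 : 0 < T) (hTup : T * M ≤ H) (hTlow : H ≤ M * T + M)
    (hH2M : 2 * M ≤ H) (hY2M : 2 * M ≤ Y) (hXHY : X = H * Y)
    (hη : η = ε / (16 * M * C')) (hδ0 : 0 ≤ δ) (hδ : δ ≤ 2 * η)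
    (h0 : B₀ ≤ H) (h2 : S ≤ 1 / T * I + T * Y) (h4 : I ≤ C' * δ * H * X) :
    B₀ + S ≤ ε * X := by
  have hY0 : 0 ≤ Y := by linarith
  have hX0 : 0 ≤ X := by rw [hXHY]; positivity
  have hC'0 : 0 < C' := by linarith
  have hMε : 1 / M ≤ ε / 8 := by
    rw [div_le_div_iff₀ hM0 (by norm_num : (0 : ℝ) < 8)]
    rw [div_le_iff₀ hε] at hM8
    linarith
  -- (i) the block `y = 0`: `H · 2M ≤ H · Y = X`
  have hi : H ≤ ε / 16 * X := by
    have h1 : H * (2 * M) ≤ X := by rw [hXHY]; exact mul_le_mul_of_nonneg_left hY2M hH0.le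
    have h2 : H ≤ X * (1 / M) / 2 := by
      rw [mul_one_div, div_div, le_div_iff₀ (by positivity)]
      linarith [h1]
    calc H ≤ X * (1 / M) / 2 := h2
      _ ≤ X * (ε / 8) / 2 := by gcongr
      _ = ε / 16 * X := by ring
  -- (ii) the main term
  have hii : 1 / T * I ≤ ε / 4 * X := by
    have hTinv : 1 / T ≤ 2 * M / H := by
      rw [div_le_div_iff₀ hT0 hH0]
      linarith
    have hI0 : 1 / T * I ≤ 1 / T * (C' * δ * H * X) :=
      mul_le_mul_of_nonneg_left h4 (by positivity)
    calc 1 / T * I ≤ 1 / T * (C' * δ * H * X) := hI0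
      _ ≤ (2 * M / H) * (C' * δ * H * X) := mul_le_mul_of_nonneg_right hTinv (by positivity)
      _ = 2 * M * C' * δ * X := by field_simp
      _ ≤ 2 * M * C' * (2 * η) * X := by gcongr
      _ = ε / 4 * X := by rw [hη]; field_simp; ring
  -- (iii) the averaging error
  have hiii : T * Y ≤ ε / 8 * X := by
    have h1 : T * Y * M ≤ X := by
      calc T * Y * M = T * M * Y := by ring
        _ ≤ H * Y := mul_le_mul_of_nonneg_right hTup hY0
        _ = X := hXHY.symm
    have h2 : T * Y ≤ X * (1 / M) := by
      rw [mul_one_div, le_div_iff₀ hM0]; exact h1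
    calc T * Y ≤ X * (1 / M) := h2
      _ ≤ X * (ε / 8) := by gcongr
      _ = ε / 8 * X := by ring
  nlinarith [mul_nonneg hε.le hX0]

end AlignedMRTWide

open AlignedMRT AlignedMRTWide in
/-- **Stub (c5 wave 2, lead): aligned Matomäki–Radziwiłł–Tao, WIDE range of depths.** For every `ε > 0` there
is `h₀` such that, eventually in `n`, for every depth `h` with `h₀ ≤ h ≤ n − h₀` and every real `α`,
`Σ_{y < 2^{n−h}} ‖Σ_{x < 2^h} λ(2^h y + x) e(α (2^h y + x))‖ ≤ ε 2ⁿ` — the Liouville function twisted by any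
linear phase has cancellation in almost all ALIGNED dyadic blocks of every length `2^h`, `h₀ ≤ h ≤ n − h₀` — i.e. ALL
scales from `2^{h₀}` up to `2ⁿ/2^{h₀}` — uniformly in `α` and `h` (the registered `stub_alignedMRT`, `Theorems/…MRTAligned`,
had `h ≤ n/2`; only the bound for the block `y = 0` changes: `2^h ≤ 2ⁿ/2^{h₀} ≤ ε2ⁿ/16`).
[cite: MatomakiRadziwillTao2015, Theorem 1.3] -/
theorem stub_alignedMRT_wide :
    ∀ ε : ℝ, 0 < ε → ∃ h₀ : ℕ, ∀ᶠ n : ℕ in atTop, ∀ h : ℕ, h₀ ≤ h → h + h₀ ≤ n → ∀ α : ℝ,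
      ∑ y ∈ range (2 ^ (n - h)),
          ‖∑ x ∈ range (2 ^ h), ((ArithmeticFunction.liouville (2 ^ h * y + x) : ℤ) : ℂ) *
              Literature.NumberTheory.LFunctions.VdC.e (α * ((2 ^ h * y + x : ℕ) : ℝ))‖ ≤ ε * 2 ^ n := by
  intro ε hε
  obtain ⟨C, hC⟩ := Tao2016.MatomakiRadziwillTao2015_theorem13_holds
  -- constants: `C' = max C 1`, `M = ⌈8/ε⌉ + 1`, `η = ε / (16 M C')`
  obtain ⟨C', hC'1, hCC'⟩ : ∃ C' : ℝ, 1 ≤ C' ∧ C ≤ C' := ⟨max C 1, le_max_right _ _, le_max_left _ _⟩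
  have hC'0 : 0 < C' := lt_of_lt_of_le one_pos hC'1
  obtain ⟨M, hM1, hM8⟩ : ∃ M : ℕ, 1 ≤ M ∧ 8 / ε ≤ (M : ℝ) := by
    refine ⟨⌈8 / ε⌉₊ + 1, Nat.le_add_left _ _, ?_⟩
    have := Nat.le_ceil (8 / ε)
    push_cast; linarith
  have hM0 : (0 : ℝ) < M := by exact_mod_cast hM1
  obtain ⟨η, hηdef⟩ : ∃ η : ℝ, η = ε / (16 * M * C') := ⟨_, rfl⟩
  have hη : 0 < η := by rw [hηdef]; positivity
  obtain ⟨h₁, hh₁⟩ := exists_loglog_div_log_le hη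
  refine ⟨max h₁ (max 4 (M + 1)), ?_⟩
  filter_upwards [eventually_inv_log_rpow_le hη] with n hn h hh0 h2n α
  -- unpack the thresholds on `h`
  have hh1 : h₁ ≤ h := le_trans (le_max_left _ _) hh0
  have hh4 : 4 ≤ h := le_trans ((le_max_left _ _).trans (le_max_right _ _)) hh0
  have hhM : M + 1 ≤ h := le_trans ((le_max_right _ _).trans (le_max_right _ _)) hh0
  have hhn : h ≤ n := by omega
  -- `H = 2^h`, `Y = 2^{n-h}`, `H Y = 2^n`
  obtain ⟨H, hHdef⟩ : ∃ H : ℕ, H = 2 ^ h := ⟨_, rfl⟩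
  obtain ⟨Y, hYdef⟩ : ∃ Y : ℕ, Y = 2 ^ (n - h) := ⟨_, rfl⟩
  have hHY : H * Y = 2 ^ n := by
    rw [hHdef, hYdef, ← pow_add, Nat.add_sub_cancel' hhn]
  have hH2M : 2 * M ≤ H := by
    have h2 : 2 ^ (M + 1) ≤ 2 ^ h := Nat.pow_le_pow_right (by norm_num) hhM
    have h3 : M < 2 ^ M := Nat.lt_two_pow_self
    have : 2 * M ≤ 2 ^ (M + 1) := by rw [pow_succ]; omega
    rw [hHdef]; omega
  have hHM : M ≤ H := by omega
  have hH16 : 16 ≤ H :=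
    hHdef ▸ le_trans (by norm_num : 16 ≤ 2 ^ 4) (Nat.pow_le_pow_right (by norm_num) hh4)
  have hY2M : 2 * M ≤ Y := by
    have h2 : 2 ^ (M + 1) ≤ 2 ^ (n - h) := Nat.pow_le_pow_right (by norm_num) (by omega)
    have h3 : M < 2 ^ M := Nat.lt_two_pow_self
    have : 2 * M ≤ 2 ^ (M + 1) := by rw [pow_succ]; omega
    rw [hYdef]; omega
  have hY0 : 0 < Y := by rw [hYdef]; positivity
  have hH0 : (0 : ℝ) < H := by exact_mod_cast (lt_of_lt_of_le (by norm_num) hH16)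
  -- rewrite the statement in terms of `H`, `Y`
  rw [← hYdef, ← hHdef]
  -- the summands as a sequence `c`
  set c : ℕ → ℂ := fun m => ((ArithmeticFunction.liouville m : ℤ) : ℂ) * VdC.e (α * m) with hcdef
  have hc : ∀ m, ‖c m‖ ≤ 1 := fun m => norm_liouville_mul_e_le α m
  -- the blocks are the window sums `V_{Hy}`
  have hblock : ∀ y : ℕ, ∑ x ∈ range H,
      ((ArithmeticFunction.liouville (H * y + x) : ℤ) : ℂ) * VdC.e (α * ((H * y + x : ℕ) : ℝ)) =
      ∑ m ∈ Ico (H * y) (H * y + H), c m := by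
    intro y
    rw [Finset.sum_Ico_eq_sum_range, Nat.add_sub_cancel_left]
  simp_rw [hblock]
  -- split off the block `y = 0`
  rw [Finset.range_eq_Ico, Finset.sum_eq_sum_Ico_succ_bot hY0, zero_add]
  -- the averaging length `T = ⌊H / M⌋`
  obtain ⟨T, hTdef⟩ : ∃ T : ℕ, T = H / M := ⟨_, rfl⟩
  have hT0 : 0 < T := hTdef ▸ Nat.div_pos hHM (by omega)
  have hTH : T ≤ H := hTdef ▸ Nat.div_le_self _ _
  have hT0' : (0 : ℝ) < T := by exact_mod_cast hT0
  have hTup : (T : ℝ) * M ≤ H := by rw [hTdef]; exact_mod_cast Nat.div_mul_le_self H M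
  have hTlow : (H : ℝ) ≤ M * T + M := by
    have h1 := Nat.div_add_mod H M
    have hmod := Nat.mod_lt H (show 0 < M by omega)
    have : H ≤ M * (H / M) + M := by omega
    rw [hTdef]; exact_mod_cast this
  -- (1) block 0
  have h0 : ‖∑ m ∈ Ico (H * 0) (H * 0 + H), c m‖ ≤ H := by
    simpa using norm_sum_Ico_le_length hc 0 H
  -- (2) aligned blocks against all windows
  have h2 := stub_window_average c hc (Y := Y) hT0 hTH
  -- (3) windows = the MRT integral
  have h3 := stub_integral_window_eq_sum c H (H * Y)
  -- (4) MRT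
  have hHX : (H : ℝ) ≤ ((H * Y : ℕ) : ℝ) := by
    have : H ≤ H * Y := Nat.le_mul_of_pos_right _ hY0
    exact_mod_cast this
  have hH10 : (10 : ℝ) ≤ H := by exact_mod_cast (le_trans (by norm_num) hH16)
  have h4 := hC (H : ℝ) ((H * Y : ℕ) : ℝ) hH10 hHX α
  rw [h3] at h4
  -- the quantity `δ`
  obtain ⟨δ, hδdef⟩ : ∃ δ : ℝ, δ = Real.log (Real.log (H : ℝ)) / Real.log (H : ℝ) +
    1 / Real.log ((H * Y : ℕ) : ℝ) ^ (1 / 700 : ℝ) := ⟨_, rfl⟩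
  rw [← hδdef] at h4
  have hδ1 : Real.log (Real.log (H : ℝ)) / Real.log (H : ℝ) ≤ η := by
    have := hh₁ h hh1
    rw [hHdef]; push_cast; exact this
  have hδ2 : 1 / Real.log ((H * Y : ℕ) : ℝ) ^ (1 / 700 : ℝ) ≤ η := by
    rw [hHY]; push_cast; exact hn
  have hlogH : 1 ≤ Real.log (H : ℝ) := by
    have h16 : (16 : ℝ) ≤ H := by exact_mod_cast hH16
    have he : Real.exp 1 ≤ (H : ℝ) := le_trans (by
      have := Real.exp_one_lt_d9; norm_num at this ⊢; linarith) h16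
    simpa using Real.log_le_log (Real.exp_pos 1) he
  have hδ0 : 0 ≤ δ := by
    have a1 : 0 ≤ Real.log (Real.log (H : ℝ)) / Real.log (H : ℝ) :=
      div_nonneg (Real.log_nonneg hlogH) (by linarith)
    have a2 : 0 ≤ 1 / Real.log ((H * Y : ℕ) : ℝ) ^ (1 / 700 : ℝ) := by
      apply div_nonneg zero_le_one
      apply Real.rpow_nonneg
      apply Real.log_nonneg
      exact_mod_cast Nat.one_le_iff_ne_zero.2 (by positivity)
    linarith
  have hδ : δ ≤ 2 * η := by linarith
  -- the MRT bound with `C'` in place of `C`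
  have h4' : ∑ a ∈ Icc 1 (H * Y), ‖∑ m ∈ Ico a (a + H), c m‖ ≤ C' * δ * H * ((H * Y : ℕ) : ℝ) := by
    refine h4.trans ?_
    have hnn : 0 ≤ δ * H * ((H * Y : ℕ) : ℝ) := by positivity
    nlinarith
  -- assemble
  have hXeq : ((H * Y : ℕ) : ℝ) = (2 : ℝ) ^ n := by rw [hHY]; push_cast; ring
  rw [← hXeq]
  have hY2M' : 2 * (M : ℝ) ≤ Y := by exact_mod_cast hY2M
  have hXHY : ((H * Y : ℕ) : ℝ) = (H : ℝ) * Y := by push_cast; ring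
  exact final_bound_wide hε hC'1 hM0 hM8 hH0 hT0' hTup hTlow (by exact_mod_cast hH2M) hY2M' hXHY
    hηdef hδ0 hδ h0 h2 h4'

end Summit.QuantumAdvantage.DigitPolyUniformity.SketchLAR

end
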